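import Literature.AnabelianGeometry.AbsoluteAnabelian.AbsTopIChains
import HarnessLib

/-!
# [AbsTopI] Theorem 4.7 (semi-absoluteness of chains of elementary operations)

S. Mochizuki, *Topics in Absolute Anabelian Geometry I: Generalities* [AbsTopI], Thm 4.7 (i)–(iv)
pp. 56–58 (manuscript pagination, lit key `paper:url-11ac98ba15fc`), over abc-iut-L4-t4's Π-chains
(`FundamentalExtension.PiChain`, [AbsTopI] Def 4.2 (iii)–(v), `AbsTopIChains.lean`); the class-level
hypotheses ([AbsTopI] Def 4.6: `AbsTopI.ConstructionDataClass`, `AbsTopI/RelativeGC.lean`) enter only in the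
follow-up `AbsTopI/SemiAbsoluteChainsHyp.lean`.  Thm 4.7 is the link of
the "Belyi cuspidalization" chain (audit `plan/L4/LC1-CHAIN.md`, row L1e) through which [AbsTopII]
Cor 3.3 / 3.7 consume the relative Grothendieck-anabelian input: "(i) the natural functors
`Chain(X̃ᵢ/Xᵢ) → Chain(Πᵢ)`, `Chain^{iso-trm}(X̃ᵢ/Xᵢ) → Chain^{iso-trm}(Πᵢ)`, `ÉtLoc(X̃ᵢ/Xᵢ) → ÉtLoc(Πᵢ)`
are equivalences of categories that are compatible with passing to type-chains; (ii) the isomorphism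
`φ` induces equivalences of categories `Chain(Π₁) ⥲ Chain(Π₂)` [...] functorial in `φ`; (iii)/(iv) the
same for `Chain^{trm}`, `DLoc` under the rel-hom-DGC".

## Typing (cell ruling θ)

* The ISOMORPHISMS of the categories `Chain(Π)` ([AbsTopI] Def 4.2 (iv): "a collection of
  isomorphisms of profinite groups `Πⱼ ≅ Ψⱼ` that are compatible with the rigidifying homomorphisms",
  for chains with identical type-chains) were not typed in `AbsTopIChains.lean`; they are typed here,
  at once in the relative form needed for (ii): `ChainGroupIsoOver φ` / `PiChainIsoOver φ` over an
  isomorphism `φ : E ≅ F` of extensions (`φ = Iso.refl E` gives the morphisms of `Chain(Π)` itself).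
  Since every automorphism of a Π-chain is the identity (loc. cit.), `Chain(Π)` is a setoid and an
  "equivalence of categories compatible with type-chains" is a bijection of isomorphism classes
  preserving type-chains and the terminal (iso)morphism predicates — this is how (ii)/(iv) are typed
  (shape (1): a closed statement about t4's group-theoretic objects; its printed proof is "the
  definitions of the various categories involved are entirely group-theoretic", p. 58, so the
  `𝒟`/envelope hypotheses of the theorem, which concern (i)/(iii), are not repeated in (ii)/(iv)).
* The scheme-side categories `Chain(X̃/X)` (Def 4.2 (i)(ii)) do not exist in the tree (FOUNDATIONS
  row 12); (i)/(iii) are typed MODEL-RELATIVELY (shape (M)) over an interface `SchemeChains` = "the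
  `X̃/X`-chains of one member `X`, with the natural functor of Rmk 4.2.1 to Π-chains", as
  `Prop`-valued predicates; the printed hypotheses (`𝒟` chain-full, rel-isom-DGC resp. rel-hom-DGC,
  GSAFG-type, envelope, (a), (b)) are the conditions under which the intended instance satisfies them
  and are carried by `AbsTopI.ConstructionDataClass` (`AbsTopI/RelativeGC.lean`; the `𝒟`-hypothesised
  forms `Thm_4_7_i_of` / `Thm_4_7_iii_of` are filed in the follow-up `AbsTopI/SemiAbsoluteChainsHyp.lean`).
PROVED in the companions: Thm 4.7 (iv) in full (`thm_4_7_iv_holds`) and the morphism half of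
(ii) (`thm_4_7_ii_morphisms`) in `AbsTopI/SemiAbsoluteChainsProofs.lean`; the OBJECT half of (ii)
for chains whose type-chain avoids • — in particular the whole `ÉtLoc` clause
(`exists_isoOver_of_isEtLocObj`) — in `AbsTopI/ChainTransport.lean` / `ChainTransportEtLoc.lean`
(transport of terms and of the operations ⋏, ⋎, ⊚ along `φ`).  What remains of the named fact
`Thm_4_7_ii` is the de-cuspidalization case • (cuspidal decomposition groups).
Typed ≠ discharged; nothing here takes a side on any disputed claim.
-/

noncomputable section

open CategoryTheory Topology
open scoped Pointwise

universe u

namespace Literature.AnabelianGeometry.AbsoluteAnabelian.AbsTopI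

open Literature.AlgebraicGeometry.Frobenioids (IsSlimGroup)
open FundamentalExtension

variable {E F : FundamentalExtension.{u}}

/-! ### Isomorphisms of Π-chains (Def 4.2 (iv)), relative to an isomorphism of extensions -/

/-- Cuspidal data `C₁` on `E` and `C₂` on `F` *correspond under* the isomorphism `φ : E ≅ F`: a
bijection of cusps under which the decomposition groups correspond up to `Π_F`-conjugacy (cuspidal
data are "given up to conjugacy", [AbsTopI] Def 4.2 (iii) (3_Π) / Lemma 4.5 (v)).  In print the
cuspidal decomposition groups are determined by `Π` (Lemma 4.5 (v)); in `AbsTopIChains.lean` they are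
an input `CuspidalData`, whence this compatibility hypothesis in Thm 4.7 (ii).
[cite: MochizukiAbsTopI2012, Def 4.2 (iii) p.49] -/
def CuspidalDataCompat (φ : E ≅ F) (C₁ : CuspidalData E) (C₂ : CuspidalData F) : Prop :=
  ∃ σ : C₁.Cusp ≃ C₂.Cusp, ∀ x : C₁.Cusp, ∃ g : F.arith,
    C₂.Dcusp (σ x) = MulAut.conj g • (C₁.Dcusp x).map φ.hom.arith.toMonoidHom

/-- An isomorphism between a term `Πⱼ` of a `Π_E`-chain and a term `Ψⱼ` of a `Π_F`-chain *over*
`φ : E ≅ F` ([AbsTopI] Def 4.2 (iv): "isomorphisms of profinite groups `Πⱼ ≅ Ψⱼ` that are compatible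
with the rigidifying homomorphisms"; here also with the structure maps to `G`, transported by
`φ.hom.gal`): a topological group isomorphism commuting with the projections to `G` and, on some open
subgroup of `Π_E` inside both rigidification domains, with the rigidifying homomorphisms.
[cite: MochizukiAbsTopI2012, Def 4.2 (iv) p.50] -/
structure ChainGroupIsoOver (φ : E ≅ F) (L₁ : E.ChainGroup) (L₂ : F.ChainGroup) : Type u where
  /-- the isomorphism `Πⱼ ≅ Ψⱼ` -/
  iso : L₁.grp ≃ₜ* L₂.grp
  /-- compatibility with the projections to `G_E ≅ G_F` -/
  proj_comm : ∀ x, L₂.proj (iso x) = φ.hom.gal (L₁.proj x)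
  /-- compatibility with the rigidifying homomorphisms on a common open subgroup of `Π_E` -/
  rig_comm : ∃ U : Subgroup E.arith, IsOpen (U : Set E.arith) ∧
    ∃ (h₁ : U ≤ L₁.dom) (h₂ : U.map φ.hom.arith.toMonoidHom ≤ L₂.dom),
      ∀ x : U, iso (L₁.rig ⟨x, h₁ x.2⟩) = L₂.rig ⟨φ.hom.arith x, h₂ ⟨x, x.2, rfl⟩⟩

/-- An isomorphism of Π-chains over `φ : E ≅ F` ([AbsTopI] Def 4.2 (iv)): identical type-chains
[hence the same length] and termwise isomorphisms over `φ` compatible with the rigidifying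
homomorphisms (indices are matched by value, to avoid casts between `Fin (len + 1)` types).  For
`φ = Iso.refl E` these are the morphisms of the category `Chain(Π_E)`.
[cite: MochizukiAbsTopI2012, Def 4.2 (iv) p.50] -/
def PiChainIsoOver (φ : E ≅ F) {C₁ : CuspidalData E} {hP₁ : IsSlimGroup E.arith}
    {hΔ₁ : IsSlimGroup E.geom} {hne₁ : E.geom ≠ ⊥} {C₂ : CuspidalData F}
    {hP₂ : IsSlimGroup F.arith} {hΔ₂ : IsSlimGroup F.geom} {hne₂ : F.geom ≠ ⊥}
    (c₁ : E.PiChain C₁ hP₁ hΔ₁ hne₁) (c₂ : F.PiChain C₂ hP₂ hΔ₂ hne₂) : Prop :=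
  c₁.len = c₂.len ∧
    (∀ (j₁ : Fin c₁.len) (j₂ : Fin c₂.len), j₁.val = j₂.val → c₁.types j₁ = c₂.types j₂) ∧
      ∀ (j₁ : Fin (c₁.len + 1)) (j₂ : Fin (c₂.len + 1)), j₁.val = j₂.val →
        Nonempty (ChainGroupIsoOver φ (c₁.term j₁) (c₂.term j₂))

namespace PiChainIsoOver

variable {φ : E ≅ F} {C₁ : CuspidalData E} {hP₁ : IsSlimGroup E.arith}
  {hΔ₁ : IsSlimGroup E.geom} {hne₁ : E.geom ≠ ⊥} {C₂ : CuspidalData F}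
  {hP₂ : IsSlimGroup F.arith} {hΔ₂ : IsSlimGroup F.geom} {hne₂ : F.geom ≠ ⊥}
  {c₁ : E.PiChain C₁ hP₁ hΔ₁ hne₁} {c₂ : F.PiChain C₂ hP₂ hΔ₂ hne₂}

/-- Isomorphic chains (over any `φ`) have the same type-chain ("with identical type-chains",
[AbsTopI] Def 4.2 (iv)). [cite: MochizukiAbsTopI2012, Def 4.2 (iv) p.50] -/
theorem typeChain_eq (h : PiChainIsoOver φ c₁ c₂) : c₁.typeChain = c₂.typeChain := by
  obtain ⟨hlen, htypes, -⟩ := h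
  unfold PiChain.typeChain
  apply List.ext_get
  · simp [hlen]
  · intro n h₁ h₂
    simp only [List.get_eq_getElem, List.getElem_ofFn]
    exact htypes ⟨n, by simpa using h₁⟩ ⟨n, by simpa using h₂⟩ rfl

/-- Hence isomorphic chains lie in the same full subcategories `Chain^{…}(Π){−}` ([AbsTopI] Def 4.2
(v)): `TypesAmong` is invariant (in particular `IsEtLocObj`, `IsDLocObj`).
[cite: MochizukiAbsTopI2012, Def 4.2 (v) p.51] -/
theorem typesAmong_iff (h : PiChainIsoOver φ c₁ c₂) (allowed : Set ElemOpType) :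
    c₁.TypesAmong allowed ↔ c₂.TypesAmong allowed := by
  obtain ⟨hlen, htypes, -⟩ := h
  constructor
  · intro h1 j₂
    rw [← htypes ⟨j₂.val, by omega⟩ j₂ rfl]
    exact h1 _
  · intro h2 j₁
    rw [htypes j₁ ⟨j₁.val, by omega⟩ rfl]
    exact h2 _

/-- The isomorphism at the LAST terms. [cite: MochizukiAbsTopI2012, Def 4.2 (iv) p.50] -/
theorem nonempty_last (h : PiChainIsoOver φ c₁ c₂) :
    Nonempty (ChainGroupIsoOver φ c₁.last c₂.last) :=
  h.2.2 (Fin.last _) (Fin.last _) (by simp [h.1])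

end PiChainIsoOver

/-! ### Isomorphisms of extensions: pointwise inverse laws -/

section IsoLemmas

variable (φ : E ≅ F)

/-- `φ⁻¹ (φ x) = x` on `Π`. [cite: MochizukiAbsTopI2012, Def 4.2 (iv) p.50] -/
theorem iso_inv_hom_arith (x : E.arith) : φ.inv.arith (φ.hom.arith x) = x :=
  DFunLike.congr_fun (FundamentalExtension.Hom.ext_iff.mp φ.hom_inv_id).1 x

/-- `φ (φ⁻¹ y) = y` on `Π`. [cite: MochizukiAbsTopI2012, Def 4.2 (iv) p.50] -/
theorem iso_hom_inv_arith (y : F.arith) : φ.hom.arith (φ.inv.arith y) = y :=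
  DFunLike.congr_fun (FundamentalExtension.Hom.ext_iff.mp φ.inv_hom_id).1 y

/-- `φ⁻¹ (φ g) = g` on `G`. [cite: MochizukiAbsTopI2012, Def 4.2 (iv) p.50] -/
theorem iso_inv_hom_gal (g : E.gal) : φ.inv.gal (φ.hom.gal g) = g :=
  DFunLike.congr_fun (FundamentalExtension.Hom.ext_iff.mp φ.hom_inv_id).2 g

/-- `φ (φ⁻¹ g) = g` on `G`. [cite: MochizukiAbsTopI2012, Def 4.2 (iv) p.50] -/
theorem iso_hom_inv_gal (g : F.gal) : φ.hom.gal (φ.inv.gal g) = g :=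
  DFunLike.congr_fun (FundamentalExtension.Hom.ext_iff.mp φ.inv_hom_id).2 g

/-- The image of an open subgroup of `Π_E` under an isomorphism of extensions is open in `Π_F`.
[cite: MochizukiAbsTopI2012, Def 4.2 (iv) p.50] -/
theorem isOpen_map_arith_of_iso {U : Subgroup E.arith} (hU : IsOpen (U : Set E.arith)) :
    IsOpen ((U.map φ.hom.arith.toMonoidHom : Subgroup F.arith) : Set F.arith) := by
  have hset : ((U.map φ.hom.arith.toMonoidHom : Subgroup F.arith) : Set F.arith) =
      φ.inv.arith ⁻¹' (U : Set E.arith) := by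
    ext y
    simp only [Subgroup.coe_map, Set.mem_image, SetLike.mem_coe, Set.mem_preimage]
    constructor
    · rintro ⟨x, hx, rfl⟩
      change φ.inv.arith (φ.hom.arith x) ∈ U
      rwa [iso_inv_hom_arith]
    · intro hy
      exact ⟨φ.inv.arith y, hy, iso_hom_inv_arith φ y⟩
  rw [hset]
  exact hU.preimage φ.inv.arith.continuous

end IsoLemmas

/-! ### Isomorphisms of chain terms compose and invert (the groupoid structure of `Chain(Π)`) -/

namespace ChainGroupIsoOver

/-- The identity isomorphism of a chain term (over `Iso.refl`). [cite: MochizukiAbsTopI2012, Def 4.2 (iv) p.50] -/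
theorem nonempty_refl (L : E.ChainGroup) : Nonempty (ChainGroupIsoOver (Iso.refl E) L L) :=
  ⟨{ iso := ContinuousMulEquiv.refl _
     proj_comm := fun _ => rfl
     rig_comm := ⟨L.dom, L.isOpen_dom, le_rfl, by
       intro y hy
       obtain ⟨x, hx, rfl⟩ := hy
       exact hx, fun _ => rfl⟩ }⟩

/-- The inverse of an isomorphism of chain terms, over `φ.symm`. [cite: MochizukiAbsTopI2012, Def 4.2 (iv) p.50] -/
def symm {φ : E ≅ F} {L₁ : E.ChainGroup} {L₂ : F.ChainGroup} (I : ChainGroupIsoOver φ L₁ L₂) :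
    ChainGroupIsoOver φ.symm L₂ L₁ where
  iso := I.iso.symm
  proj_comm := fun y => by
    have h := I.proj_comm (I.iso.symm y)
    rw [ContinuousMulEquiv.apply_symm_apply] at h
    change L₁.proj (I.iso.symm y) = φ.inv.gal (L₂.proj y)
    rw [h, iso_inv_hom_gal]
  rig_comm := by
    obtain ⟨U, hUo, h₁, h₂, hrig⟩ := I.rig_comm
    refine ⟨U.map φ.hom.arith.toMonoidHom, isOpen_map_arith_of_iso φ hUo, h₂, ?_, ?_⟩
    · -- `φ⁻¹(φ(U)) = U ≤ dom L₁`
      intro x hx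
      obtain ⟨y, hy, rfl⟩ := hx
      obtain ⟨x, hxU, rfl⟩ := hy
      change φ.inv.arith (φ.hom.arith x) ∈ L₁.dom
      rw [iso_inv_hom_arith]
      exact h₁ hxU
    · rintro ⟨y, hy⟩
      obtain ⟨x, hxU, rfl⟩ := hy
      apply I.iso.injective
      rw [ContinuousMulEquiv.apply_symm_apply]
      have hx : φ.inv.arith (φ.hom.arith x) = x := iso_inv_hom_arith φ x
      have e1 : (⟨(φ.symm.hom.arith : F.arith → E.arith) (φ.hom.arith.toMonoidHom x), by
          change φ.inv.arith (φ.hom.arith x) ∈ L₁.dom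
          rw [iso_inv_hom_arith]; exact h₁ hxU⟩ : L₁.dom) = ⟨x, h₁ hxU⟩ := by
        apply Subtype.ext
        exact hx
      change L₂.rig ⟨φ.hom.arith x, h₂ ⟨x, hxU, rfl⟩⟩ = I.iso (L₁.rig ⟨φ.symm.hom.arith _, _⟩)
      rw [e1, hrig ⟨x, hxU⟩]

/-- Composition of isomorphisms of chain terms, over `φ ≪≫ ψ`. [cite: MochizukiAbsTopI2012, Def 4.2 (iv) p.50] -/
def trans {K : FundamentalExtension.{u}} {φ : E ≅ F} {ψ : F ≅ K} {L₁ : E.ChainGroup}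
    {L₂ : F.ChainGroup} {L₃ : K.ChainGroup} (I : ChainGroupIsoOver φ L₁ L₂)
    (J : ChainGroupIsoOver ψ L₂ L₃) : ChainGroupIsoOver (φ ≪≫ ψ) L₁ L₃ where
  iso := I.iso.trans J.iso
  proj_comm := fun x => by
    change L₃.proj (J.iso (I.iso x)) = (φ.hom ≫ ψ.hom).gal (L₁.proj x)
    rw [J.proj_comm, I.proj_comm, comp_gal]
    rfl
  rig_comm := by
    obtain ⟨U, hUo, hU₁, hU₂, hrigI⟩ := I.rig_comm
    obtain ⟨V, hVo, hV₁, hV₂, hrigJ⟩ := J.rig_comm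
    refine ⟨U ⊓ V.comap φ.hom.arith.toMonoidHom, ?_, fun x hx => hU₁ hx.1, ?_, ?_⟩
    · rw [Subgroup.coe_inf, Subgroup.coe_comap]
      exact hUo.inter (hVo.preimage φ.hom.arith.continuous)
    · intro z hz
      obtain ⟨x, hx, rfl⟩ := hz
      have hxV : φ.hom.arith x ∈ V := hx.2
      exact hV₂ ⟨φ.hom.arith x, hxV, rfl⟩
    · rintro ⟨x, hx⟩
      have hxU : x ∈ U := hx.1
      have hxV : φ.hom.arith x ∈ V := hx.2
      change J.iso (I.iso (L₁.rig ⟨x, hU₁ hxU⟩)) = L₃.rig ⟨ψ.hom.arith (φ.hom.arith x), _⟩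
      rw [hrigI ⟨x, hxU⟩]
      exact hrigJ ⟨φ.hom.arith x, hxV⟩

end ChainGroupIsoOver

/-! ### Theorem 4.7 (ii), (iv): the group-theoretic categories are functorial in `φ` -/

/-- **[AbsTopI] Theorem 4.7 (ii)** p. 57 (shape (1), closed): "The isomorphism `φ` induces
equivalences of categories `Chain(Π₁) ⥲ Chain(Π₂)`; `Chain^{iso-trm}(Π₁) ⥲ Chain^{iso-trm}(Π₂)`;
`ÉtLoc(Π₁) ⥲ ÉtLoc(Π₂)` that are compatible with passing to type-chains and functorial in `φ`."
Here `φ : E ≅ F` is an isomorphism of extensions (= "an isomorphism of profinite groups that induces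
isomorphisms `φ_Δ : Δ₁ ≅ Δ₂`, `φ_G : G₁ ≅ G₂`", p. 56) and the cuspidal data correspond under `φ`;
TYPED as: every `Π_E`-chain is isomorphic over `φ` to some `Π_F`-chain and conversely, and the
correspondence respects isomorphy (so it is a bijection of isomorphism classes, i.e. an equivalence of
the setoids `Chain(Πᵢ)`), type-chains (`PiChainIsoOver.typeChain_eq`, hence `ÉtLoc`), and terminal
isomorphisms (`Chain^{iso-trm}`).  Printed proof: "the definitions of the various categories
involved are entirely group-theoretic" (p. 58) — the `𝒟`/envelope hypotheses of Thm 4.7 concern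
(i)/(iii) and are not repeated.  Functoriality in `φ` is not typed. Named fact.
[cite: MochizukiAbsTopI2012, Thm 4.7 (ii) p.57] -/
def Thm_4_7_ii : Prop :=
  ∀ (E F : FundamentalExtension.{u}) (φ : E ≅ F) (C₁ : CuspidalData E) (C₂ : CuspidalData F)
    (hP₁ : IsSlimGroup E.arith) (hΔ₁ : IsSlimGroup E.geom) (hne₁ : E.geom ≠ ⊥)
    (hP₂ : IsSlimGroup F.arith) (hΔ₂ : IsSlimGroup F.geom) (hne₂ : F.geom ≠ ⊥),
    CuspidalDataCompat φ C₁ C₂ →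
      (∀ c₁ : E.PiChain C₁ hP₁ hΔ₁ hne₁, ∃ c₂ : F.PiChain C₂ hP₂ hΔ₂ hne₂, PiChainIsoOver φ c₁ c₂) ∧
      (∀ c₂ : F.PiChain C₂ hP₂ hΔ₂ hne₂, ∃ c₁ : E.PiChain C₁ hP₁ hΔ₁ hne₁, PiChainIsoOver φ c₁ c₂) ∧
      ∀ (c₁ c₁' : E.PiChain C₁ hP₁ hΔ₁ hne₁) (c₂ c₂' : F.PiChain C₂ hP₂ hΔ₂ hne₂),
        PiChainIsoOver φ c₁ c₂ → PiChainIsoOver φ c₁' c₂' →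
          (PiChainIsoOver (Iso.refl E) c₁ c₁' ↔ PiChainIsoOver (Iso.refl F) c₂ c₂') ∧
          (c₁.HasTerminalIso c₁' ↔ c₂.HasTerminalIso c₂')

/-- **[AbsTopI] Theorem 4.7 (iv)** p. 57 (shape (1), closed): "In the situation of (iii), the
isomorphism `φ` induces equivalences of categories `Chain^{trm}(Π₁) ⥲ Chain^{trm}(Π₂)`;
`DLoc(Π₁) ⥲ DLoc(Π₂)` that are compatible with passing to type-chains and functorial in `φ`" —
TYPED as the (ii)-correspondence respecting terminal HOMOMORPHISMS (the morphisms of `Chain^{trm}`;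
`DLoc` is the full subcategory on type-chains in `{⋏, •}`, preserved by `PiChainIsoOver.typesAmong_iff`).
The printed hypotheses of (iii) (rel-hom-DGC, `Xᵢ` hyperbolic orbicurves) concern the scheme side and
are not repeated (proof p. 58: group-theoreticity of the definitions).  Named fact.
[cite: MochizukiAbsTopI2012, Thm 4.7 (iv) p.57] -/
def Thm_4_7_iv : Prop :=
  ∀ (E F : FundamentalExtension.{u}) (φ : E ≅ F) (C₁ : CuspidalData E) (C₂ : CuspidalData F)
    (hP₁ : IsSlimGroup E.arith) (hΔ₁ : IsSlimGroup E.geom) (hne₁ : E.geom ≠ ⊥)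
    (hP₂ : IsSlimGroup F.arith) (hΔ₂ : IsSlimGroup F.geom) (hne₂ : F.geom ≠ ⊥),
    CuspidalDataCompat φ C₁ C₂ →
      ∀ (c₁ c₁' : E.PiChain C₁ hP₁ hΔ₁ hne₁) (c₂ c₂' : F.PiChain C₂ hP₂ hΔ₂ hne₂),
        PiChainIsoOver φ c₁ c₂ → PiChainIsoOver φ c₁' c₂' →
          (c₁.HasTerminalHom c₁' ↔ c₂.HasTerminalHom c₂')

/-! ### Theorem 4.7 (i), (iii): scheme-theoretic chains vs Π-chains (model-relative) -/

/-- INTERFACE for the SCHEME side of [AbsTopI] Def 4.2 (i)(ii) and Rmk 4.2.1 p. 51, for one member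
`X` (with envelope `α : π₁^tame(X) ↠ Π`, cuspidal data `C`): the `X̃/X`-chains (`Obj`), their
images under "the natural functor `Chain(X̃/X) → Chain(Π)`" (`toPiChain` — "the resulting profinite
groups `Πⱼ` determine a Π-chain with the same associated type-chain"), the isomorphisms of
`Chain(X̃/X)` (`ChainIso`), the terminal morphisms "a dominant `k`-morphism `X_n → Y_m`" (`HasTerminalMor`)
and terminal isomorphisms, with the functor's action on them.  No instance in the tree (FOUNDATIONS
row 12); shape (M). [cite: MochizukiAbsTopI2012, Rmk 4.2.1 p.51] -/
structure SchemeChains (E : FundamentalExtension.{u}) (C : CuspidalData E) (hP : IsSlimGroup E.arith)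
    (hΔ : IsSlimGroup E.geom) (hne : E.geom ≠ ⊥) : Type (u + 1) where
  /-- the `X̃/X`-chains -/
  Obj : Type u
  /-- the natural functor of Rmk 4.2.1 on objects -/
  toPiChain : Obj → E.PiChain C hP hΔ hne
  /-- isomorphy in `Chain(X̃/X)` (Def 4.2 (ii)) -/
  ChainIso : Obj → Obj → Prop
  /-- existence of a terminal morphism (a dominant `k`-morphism of last terms; `Chain^{trm}(X̃/X)`) -/
  HasTerminalMor : Obj → Obj → Prop
  /-- existence of a terminal isomorphism (`Chain^{iso-trm}(X̃/X)`) -/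
  HasTerminalIso : Obj → Obj → Prop
  /-- the functor on isomorphisms -/
  map_iso : ∀ x y, ChainIso x y → PiChainIsoOver (CategoryTheory.Iso.refl E) (toPiChain x) (toPiChain y)
  /-- the functor on terminal morphisms -/
  map_terminalMor : ∀ x y, HasTerminalMor x y → (toPiChain x).HasTerminalHom (toPiChain y)
  /-- the functor on terminal isomorphisms -/
  map_terminalIso : ∀ x y, HasTerminalIso x y → (toPiChain x).HasTerminalIso (toPiChain y)

namespace SchemeChains

variable {C : CuspidalData E} {hP : IsSlimGroup E.arith} {hΔ : IsSlimGroup E.geom} {hne : E.geom ≠ ⊥}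
  (S : SchemeChains E C hP hΔ hne)

/-- **[AbsTopI] Theorem 4.7 (i)** p. 57, as a property of a scheme-chain datum `S` (shape (M)): "the
natural functors `Chain(X̃/X) → Chain(Π)`, `Chain^{iso-trm}(X̃/X) → Chain^{iso-trm}(Π)`,
`ÉtLoc(X̃/X) → ÉtLoc(Π)` are equivalences of categories that are compatible with passing to
type-chains": essentially surjective on Π-chains up to isomorphy, and full on isomorphisms and on
terminal isomorphisms (faithfulness is automatic at the level of these `Prop`-valued morphism
predicates; type-chain compatibility is built into `toPiChain`/`PiChainIsoOver`).  Print asserts this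
for the genuine `X̃/X`-chains under: `𝒟` chain-full with rel-isom-DGC, `G` slim, GSAFG-type with
base-prime partial construction data in `𝒟`, envelope `α`, (a), (b) — see `Thm_4_7_i_of` in
`SemiAbsoluteChainsHyp.lean`. [cite: MochizukiAbsTopI2012, Thm 4.7 (i) p.57] -/
def Thm_4_7_i : Prop :=
  (∀ c : E.PiChain C hP hΔ hne, ∃ x : S.Obj, PiChainIsoOver (Iso.refl E) (S.toPiChain x) c) ∧
  (∀ x y : S.Obj, PiChainIsoOver (Iso.refl E) (S.toPiChain x) (S.toPiChain y) → S.ChainIso x y) ∧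
  (∀ x y : S.Obj, (S.toPiChain x).HasTerminalIso (S.toPiChain y) → S.HasTerminalIso x y)

/-- **[AbsTopI] Theorem 4.7 (iii)** p. 57, as a property of `S` (shape (M)): "Suppose further that
the rel-hom-DGC holds, and that `Xᵢ` is a hyperbolic orbicurve. Then the natural functors
`Chain^{trm}(X̃/X) → Chain^{trm}(Π)`, `DLoc(X̃/X) → DLoc(Π)` are equivalences of categories compatible
with passing to type-chains": fullness on terminal MORPHISMS (with `Thm_4_7_i` for the objects).
[cite: MochizukiAbsTopI2012, Thm 4.7 (iii) p.57] -/
def Thm_4_7_iii : Prop :=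
  ∀ x y : S.Obj, (S.toPiChain x).HasTerminalHom (S.toPiChain y) → S.HasTerminalMor x y

end SchemeChains

end Literature.AnabelianGeometry.AbsoluteAnabelian.AbsTopI
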